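import Summits.HubbardSuperconductivity.HubbardSuperconductivity.Theorems.MesoscopicPairOrder.Negative.StonerModerateCoupling
import Literature.MathematicalPhysics.QuantumLattice.PairedProductStatesInteraction
import HarnessLib

/-!
# Crux `MesoscopicPairOrder` (stmt-HubbardSuperconductivity-7331), Negative side:
# the Stoner ceilings with the EXACT doublon density `n²/L²` of the paired Fermi sea

Line `redirect_birth` (lead c10). The Stoner-type spin ceilings of `StonerBound.lean` (band edge),
`StonerShiftedBand.lean` (chemical-potential shift) bound the trial energy of the paired Fermi sea
`Φ_l` through the crude doublon count `⟨D⟩ ≤ n`. With the exact Hartree–Fock value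
`Re⟨Φ_l, Σ_x n_x↑ n_x↓ Φ_l⟩ = n²/L²` (`re_expect_interaction_pairedState`,
Literature/…/PairedProductStatesInteraction.lean) the interaction term `U n` becomes `U n²/L²`
(a factor `ν = n/L² ≤ 0.45`):

* `eight_spin_le_of_pairedSea_exact` — **`8S ≤ 4L² + 2Σ_{k∈l} ε_L(k) + U n²/L²`**;
* `shifted_spin_le_of_pairedSea_exact` — **`(μ + 4)(n - S) ≥ 2μ n - L²(4+t²)/(4(t-μ)) - 2Σ_l ε - U n²/L²`**
  (`t > μ`);
for every ground multiplet of spin `S` of the `(2n, S^z = 0)` sector of `hubbardTorus 2 L 1 U` (any real `U`)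
and every duplicate-free list `l` of `n` momenta. The lattice-sum evaluation (no near-saturation for
`U ≤ 7/2` on `δ ∈ [1/10, 3/10]`) is the companion file `StonerExactDoublonBox.lean`.

Sources: E. C. Stoner, Proc. R. Soc. A 165 (1938) 372; D. R. Penn, Phys. Rev. 142 (1966) 350, §II;
H. Tasaki, Prog. Theor. Phys. 99 (1998) 489, §5. Folklore finite-dimensional statements; no definition,
no named fact, no sorry.
-/

noncomputable section

-- the summit namespace repeats the problem name by design (D-0017)
set_option linter.dupNamespace false

namespace Summit.HubbardSuperconductivity.HubbardSuperconductivity.Theorems.MesoscopicPairOrder.Negative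

open Matrix Finset Filter
open Literature.Probability.LatticeModels Literature.MathematicalPhysics.QuantumLattice
open scoped ComplexOrder ComplexConjugate

section Exact

variable {L : ℕ} [NeZero L]

/-- The energy of the paired Fermi sea `Φ_l` (duplicate-free `l` of `n` momenta, `L ≥ 3`) is EXACTLY the
Hartree–Fock value `2Σ_{k∈l} ε_L(k) + U n²/L²`. Penn (1966) §II. [folklore] -/
theorem re_expect_hubbardTorus_pairedState (hL : 3 ≤ L) (U : ℝ) {n : ℕ} {l : List (TorusSite 2 L)}
    (hl : l.Nodup) (hlen : l.length = n) :
    (star ((List.map (fun q : TorusSite 2 L => (pairMode q)ᴴ) l).prod *ᵥ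
        (vacuum : Fock (Orb (FermionTorus 2 L)))) ⬝ᵥ
      (hubbardTorus 2 L 1 U *ᵥ ((List.map (fun q : TorusSite 2 L => (pairMode q)ᴴ) l).prod *ᵥ
        (vacuum : Fock (Orb (FermionTorus 2 L)))))).re =
      2 * ∑ k ∈ l.toFinset, torusBand L k + U * ((n : ℝ) ^ 2 / (L : ℝ) ^ 2) := by
  rw [hubbardTorus_eq_zero_add_smul_interaction U, add_mulVec, Matrix.smul_mulVec, dotProduct_add,
    dotProduct_smul, smul_eq_mul, Complex.add_re, Complex.re_ofReal_mul,
    re_expect_hubbardTorus_zero_pairedState hL hl, re_expect_interaction_pairedState hl, hlen]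

/-- **BAND-EDGE STONER CEILING WITH THE EXACT DOUBLON DENSITY**: for `L ≥ 3`, any real `U`, a ground state
`ψ` of the `(2n, S^z = 0)` sector of `hubbardTorus 2 L 1 U` with `S² ψ = S(S+1) ψ`, `S ≤ n`, `0 ≤ U`, and any
duplicate-free list `l` of `n` momenta: `8S ≤ 4L² + 2Σ_{k∈l} ε_L(k) + U n²/L²`
(`eight_spin_le_of_trial` with `Φ_l`, `re_expect_hubbardTorus_pairedState`). [folklore] -/
theorem eight_spin_le_of_pairedSea_exact (hL : 3 ≤ L) {U : ℝ} (hU : 0 ≤ U) {n S : ℕ} (hS : S ≤ n)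
    {ψ : Fock (Orb (FermionTorus 2 L))} (hgs : IsGroundStateInSector (hubbardTorus 2 L 1 U) (2 * n) 0 ψ)
    (hspin : spinSq *ᵥ ψ = (((S : ℝ) * ((S : ℝ) + 1) : ℝ) : ℂ) • ψ)
    {l : List (TorusSite 2 L)} (hl : l.Nodup) (hlen : l.length = n) :
    8 * (S : ℝ) ≤ 4 * (L : ℝ) ^ 2 + 2 * ∑ k ∈ l.toFinset, torusBand L k + U * ((n : ℝ) ^ 2 / (L : ℝ) ^ 2) := by
  set Φ : Fock (Orb (FermionTorus 2 L)) :=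
    (List.prod (List.map (fun q : TorusSite 2 L => (pairMode q)ᴴ) l)) *ᵥ
      (vacuum : Fock (Orb (FermionTorus 2 L))) with hΦ_def
  have hΦmem : Φ ∈ szSector (Λ := FermionTorus 2 L) (2 * n) 0 := by
    have h := pairedState_mem_szSector (L := L) l
    rwa [hlen] at h
  have hΦ1 : star Φ ⬝ᵥ Φ = 1 := star_pairedState_dotProduct_self hl
  have h := eight_spin_le_of_trial hL hU hS hgs hspin hΦmem hΦ1
  rw [hΦ_def, re_expect_hubbardTorus_pairedState hL U hl hlen] at h
  linarith

/-- **SHIFTED STONER CEILING WITH THE EXACT DOUBLON DENSITY**: for `L ≥ 3`, `0 ≤ U`, `t > μ`, a ground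
state `ψ` of the `(2n, S^z = 0)` sector with `S² ψ = S(S+1) ψ`, `S ≤ n`, and any duplicate-free list `l` of
`n` momenta: `2μ n - L²(4+t²)/(4(t-μ)) - 2Σ_{k∈l} ε_L(k) - U n²/L² ≤ (μ + 4)(n - S)`
(`shifted_spin_le_of_groundState`, variational principle with `Φ_l`, `re_expect_hubbardTorus_pairedState`).
[folklore] -/
theorem shifted_spin_le_of_pairedSea_exact (hL : 3 ≤ L) {U : ℝ} (hU : 0 ≤ U) {n S : ℕ} (hS : S ≤ n)
    {ψ : Fock (Orb (FermionTorus 2 L))} (hgs : IsGroundStateInSector (hubbardTorus 2 L 1 U) (2 * n) 0 ψ)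
    (hspin : spinSq *ᵥ ψ = (((S : ℝ) * ((S : ℝ) + 1) : ℝ) : ℂ) • ψ)
    {l : List (TorusSite 2 L)} (hl : l.Nodup) (hlen : l.length = n) {μ t : ℝ} (hμt : μ < t) :
    2 * μ * n - (L : ℝ) ^ 2 * (4 + t ^ 2) / (4 * (t - μ)) - 2 * ∑ k ∈ l.toFinset, torusBand L k -
        U * ((n : ℝ) ^ 2 / (L : ℝ) ^ 2) ≤ (μ + 4) * ((n : ℝ) - S) := by
  have h := shifted_spin_le_of_groundState hL hU hS hgs hspin hμt
  set Φ : Fock (Orb (FermionTorus 2 L)) :=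
    (List.prod (List.map (fun q : TorusSite 2 L => (pairMode q)ᴴ) l)) *ᵥ
      (vacuum : Fock (Orb (FermionTorus 2 L))) with hΦ_def
  have hΦmem : Φ ∈ szSector (Λ := FermionTorus 2 L) (2 * n) 0 := by
    have h := pairedState_mem_szSector (L := L) l
    rwa [hlen] at h
  have hΦ1 : star Φ ⬝ᵥ Φ = 1 := star_pairedState_dotProduct_self hl
  have hH : (hubbardTorus 2 L 1 U).IsHermitian := LiebThm1.hamiltonian_isHermitian _ 1 U
  have hvar := minEnergyOn_le_rayleigh_of_mem hH _ hΦmem hΦ1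
  rw [hΦ_def, re_expect_hubbardTorus_pairedState hL U hl hlen] at hvar
  linarith

end Exact

end Summit.HubbardSuperconductivity.HubbardSuperconductivity.Theorems.MesoscopicPairOrder.Negative
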